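/-
Origin: expansion seat `planner-pub-hodgecm-pv06-g2-0`, handover 2026-08-18T04:57:56Z (`HOME/pub-hodgecm-pv06-g2/lean/Pv06g2/CharSeparation.lean`, md5 66a9adfc, 579 lines);
landed by the gen-6 packager in gate run 22 as `HodgeCM/PerL34/CharSeparation.lean` (verbatim).
-/
/-
Origin: HOME/pub-hodgecm-pv06-g2/lean/Pv06g2/CharSeparation.lean — session planner-pub-hodgecm-pv06-g2-0 (unit
pub-hodgecm-pv06-g2, DAG-NODE PROVER #06 of 15, generation 2).  Intended final place: `HodgeCM/PerL34/CharSeparation.lean`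
(namespace `HodgeCM.PerL34.CharSeparation`; rename the module `Pv06g2.CharSeparation` ↦ `HodgeCM.PerL34.CharSeparation`).
Imports: Mathlib + `HodgeCM.PerL34.KernelOperator` (pv05, gate run 19).  Every declaration below is closed
(no placeholders, no new constants, nothing cited): `#print axioms charSeparating` = [propext, Classical.choice, Quot.sound].
-/
import Mathlib
import Summits.HodgeConjecture.HodgeCM.PerL34.KernelOperator

set_option autoImplicit false

/-!
# Characters separate points of a compact abelian group (KERNEL; discharges the PRINT leaf `CharSeparating`)

**The leaf (verbatim, as carried in the tree).**  pv11 `HodgeCM.PerL34.SupplyElementary.CharSeparating G :=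
∀ g h : G, g ≠ h → ∃ χ : PontryaginDual G, χ g ≠ χ h` — the ONLY non-Mathlib input of route (E) `supply_elementary`
(LEMMAS.md §10 SUPPLY), quoted there from Einsiedler–Ward, *Functional Analysis, Spectral Theory, and Applications*
(GTM 276), Theorem 12.84 "characters separate points"; and the hypothesis
`hsep : ∀ k₁ k₂ : K, k₁ ≠ k₂ → ∃ χ : PontryaginDual K, χ k₁ ≠ χ k₂` of pv06 (gen 1)
`HodgeCM.PerL34.CharCompleteness.eq_zero_of_forall_character_orthogonal` (node N23c, the `fourier` field of
`AnnihilationDatum`: PerL v5 tex l. 425 "by completeness of characters of the compact abelian group `[T]`").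
The groups in play (`[T] = T(L₀)\T(𝔸_{L₀})`, `[U(W_j)]`, tex ll. 299–304, 411–425) are compact Hausdorff abelian.

**What is proved here (Mathlib generality, no hypothesis left).**  For every compact Hausdorff abelian topological
group `G`:

* `exists_char_ne_one : a ≠ 1 → ∃ χ : G →ₜ* Circle, χ a ≠ 1`;
* `charSeparating : ∀ g h : G, g ≠ h → ∃ χ : PontryaginDual G, χ g ≠ χ h` — this is `CharSeparating G` ON THE NOSE
  (pv11's `def` unfolds to it definitionally, so `CharSeparation.charSeparating` can be passed wherever
  `(hsep : CharSeparating G)` or CharCompleteness's `hsep` is expected).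

**Proof (Peter–Weyl for compact abelian groups, self-contained).**  Fix a finite left-invariant Borel measure `μ`
positive on opens and regular (Haar).  (§2) The regular representation `τ_a v = v ∘ (a⁻¹·)` on `L²(μ)`
(`Lp.compMeasurePreserving`): isometric, a group action, `τ_a* = τ_{a⁻¹}` (`inner_τ_left`), strongly continuous
(`continuous_τ_apply`, from Mathlib's `Lp.compMeasurePreserving_continuous`).  (§1, §3) For `k ∈ C(G)` the operator
`T_k v (x) = ∫ k(x⁻¹y) v(y) dμ(y)` is pv05's `KernelOperator.opT` of the continuous kernel `K_k(x,y) = k(x⁻¹y)`; it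
commutes with every `τ_a` (`τ_T`, via pv05's `opT_comp_eq`) and is COMPACT (`isCompactOperator_opT`: the image of the
unit ball in `C(G)` is bounded and equicontinuous — equicontinuity being the continuity of `x ↦ K(x,·) ∈ L²`, pv05's
`continuous_kx` — so Arzelà–Ascoli `BoundedContinuousFunction.arzela_ascoli` applies, and `C(G) → L²` is continuous);
and a vector killed by all `T_k` is zero (`eq_zero_of_forall_T_eq_zero`: evaluate the continuous function `T_k v` at
`1` and use density of `C(G)` in `L²`, `ContinuousMap.toLp_denseRange`).  (§6) Suppose every character is `1` at `a`.
Let `W` be the fixed space of `τ_a`, `U = Wᗮ`, `P` the orthogonal projection onto `U`; `W`, `U` are invariant under all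
translations (commutativity of `G` + unitarity), so `P` commutes with them (§5).  If `U ≠ 0`, pick `v ∈ U`, `v ≠ 0`, and
`k` with `T_k v ≠ 0`; `S := (T_k P)*(T_k P)` is compact, self-adjoint, non-zero (`⟪Sv,v⟫ = ‖T_k v‖²`) and commutes with
all `τ_b` (`adjoint_τ_comm`).  By Mathlib's spectral theorem for compact self-adjoint operators
(`ContinuousLinearMap.eq_zero_of_forall_hasEigenvalue_eq_zero`, `finite_dimensional_eigenspace`) `S` has an eigenvalue
`c ≠ 0` with finite-dimensional eigenspace `E`; `E ⊆ range P ⊆ U` and `E` is translation-invariant.  (§4, Schur) A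
commuting family of linear maps has, inside any invariant finite-dimensional `E ≠ 0`, a common eigenspace `F ≠ 0`
(minimise the dimension of a non-zero invariant subspace; `Module.End.exists_eigenvalue` over `ℂ`).  On `F` each `τ_b`
is a scalar `c(b)`; `b ↦ c(b)` is multiplicative, unimodular and continuous, i.e. a continuous unitary character `χ`,
so `c(a) = χ(a) = 1`: a non-zero `x₀ ∈ F ⊆ U = Wᗮ` is FIXED by `τ_a`, i.e. lies in `W ∩ Wᗮ = 0` — contradiction.
Hence `W = L²`: every `f ∈ C(G)` satisfies `f ∘ (a⁻¹·) = f` (`toLp` is injective on continuous functions for a measure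
positive on opens), so `f(a⁻¹) = f(1)` for all continuous `f`, contradicting Urysohn (`G` compact Hausdorff, hence
normal) when `a ≠ 1`.  (§7) instantiates `μ :=` Haar measure on the Borel σ-algebra (`borelize`).

Commutativity of `G` is used exactly twice (translations commute with each other; left translations commute with the
right-convolution operators `T_k` is automatic); compactness gives finiteness of Haar measure, `C(G) ⊂ L²`, and
Arzelà–Ascoli.  No Pontryagin duality, no Peter–Weyl theorem and no Stone–Weierstrass is imported: the file IS a proof
of the abelian Peter–Weyl / Pontryagin–van Kampen separation theorem from Mathlib's compact-operator spectral theory.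
-/

noncomputable section

namespace HodgeCM
namespace PerL34
namespace CharSeparation

open MeasureTheory Topology ComplexConjugate Filter
open scoped InnerProductSpace ENNReal

/-! ## 1. Compactness of a continuous-kernel operator on `L²` of a compact space (Arzelà–Ascoli) -/

section Compact

variable {X Y : Type*} [TopologicalSpace X] [CompactSpace X] [TopologicalSpace Y] [CompactSpace Y]
  [MeasurableSpace X] [BorelSpace X] [MeasurableSpace Y] [BorelSpace Y]

open KernelOperator BoundedContinuousFunction in
/-- A continuous kernel on a product of compact spaces with finite measures defines a COMPACT operator
`L²(ν) → L²(μ)`: the image of the unit ball under `v ↦ 𝒯_k v ∈ C(X, ℂ)` is bounded and equicontinuous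
(equicontinuity = continuity of `x ↦ k(x, ·) ∈ L²(ν)`), hence relatively compact in `C(X, ℂ)` by Arzelà–Ascoli,
and `C(X, ℂ) → L²(μ)` is continuous. -/
theorem isCompactOperator_opT (k : C(X × Y, ℂ)) (μ : Measure X) [IsFiniteMeasure μ] (ν : Measure Y)
    [IsFiniteMeasure ν] : IsCompactOperator (opT k μ ν) := by
  classical
  -- the isometric identification `C(X, ℂ) ≃ᵢ (X →ᵇ ℂ)`
  let e : C(X, ℂ) ≃ᵢ (X →ᵇ ℂ) := ContinuousMap.isometryEquivBoundedOfCompact X ℂ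
  let A : Set (X →ᵇ ℂ) := (fun v => e (evalTC k ν v)) '' Metric.closedBall (0 : Lp ℂ 2 ν) 1
  set R : ℝ := (measureUnivNNReal ν : ℝ) ^ (2 : ℝ)⁻¹ * ‖k‖ with hR
  have hA_in : ∀ (f : X →ᵇ ℂ) (x : X), f ∈ A → f x ∈ Metric.closedBall (0 : ℂ) R := by
    rintro f x ⟨v, hv, rfl⟩
    rw [Metric.mem_closedBall, dist_zero_right] at hv ⊢
    change ‖evalT k ν v x‖ ≤ R
    calc ‖evalT k ν v x‖ ≤ (measureUnivNNReal ν : ℝ) ^ (2 : ℝ)⁻¹ * ‖k‖ * ‖v‖ := norm_evalT_le k ν v x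
      _ ≤ (measureUnivNNReal ν : ℝ) ^ (2 : ℝ)⁻¹ * ‖k‖ * 1 := by gcongr
      _ = R := by rw [hR, mul_one]
  have hA_eq : Equicontinuous ((↑) : A → X → ℂ) := by
    intro x₀
    rw [Metric.equicontinuousAt_iff_right]
    intro ε hε
    have hcont := (continuous_kx k ν).tendsto x₀
    have hball : Metric.ball (kx k ν x₀) ε ∈ 𝓝 (kx k ν x₀) := Metric.ball_mem_nhds _ hε
    filter_upwards [hcont hball] with x hx
    rintro ⟨f, ⟨v, hv, rfl⟩⟩
    rw [Metric.mem_closedBall, dist_zero_right] at hv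
    rw [Set.mem_preimage, Metric.mem_ball, dist_eq_norm] at hx
    change dist (evalT k ν v x₀) (evalT k ν v x) < ε
    rw [dist_eq_norm]
    unfold evalT
    rw [← inner_sub_left]
    calc ‖⟪kx k ν x₀ - kx k ν x, v⟫_ℂ‖ ≤ ‖kx k ν x₀ - kx k ν x‖ * ‖v‖ := norm_inner_le_norm _ _
      _ ≤ ‖kx k ν x₀ - kx k ν x‖ * 1 := by gcongr
      _ = ‖kx k ν x - kx k ν x₀‖ := by rw [mul_one, norm_sub_rev]
      _ < ε := hx
  have hAc : IsCompact (closure A) :=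
    arzela_ascoli (Metric.closedBall (0 : ℂ) R) (isCompact_closedBall _ _) A hA_in hA_eq
  -- transport back to `L²(μ)`
  let Φ : (X →ᵇ ℂ) → Lp ℂ 2 μ := fun f => ContinuousMap.toLp (E := ℂ) 2 μ ℂ (e.symm f)
  have hΦ : Continuous Φ :=
    (ContinuousMap.toLp (E := ℂ) 2 μ ℂ).continuous.comp e.symm.continuous
  rw [isCompactOperator_iff_exists_mem_nhds_image_subset_compact]
  refine ⟨Metric.closedBall 0 1, Metric.closedBall_mem_nhds _ one_pos, Φ '' closure A, hAc.image hΦ, ?_⟩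
  rintro _ ⟨v, hv, rfl⟩
  refine ⟨e (evalTC k ν v), subset_closure ⟨v, hv, rfl⟩, ?_⟩
  change ContinuousMap.toLp (E := ℂ) 2 μ ℂ (e.symm (e (evalTC k ν v))) = opT k μ ν v
  rw [e.symm_apply_apply, opT_eq_toLp]

end Compact

/-! ## 2. Translations on `L²(G)` -/

section Sigma

variable {G : Type*} [CommGroup G] [TopologicalSpace G] [IsTopologicalGroup G]

/-- The translation `σ_a : x ↦ a⁻¹ * x`, as a continuous self-map of `G`. -/
def σ (a : G) : C(G, G) := ⟨fun x => a⁻¹ * x, by fun_prop⟩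

/-- (Ported verbatim from the HodgeCMPerL package; no docstring in the source.) -/
@[simp] theorem σ_apply (a x : G) : σ a x = a⁻¹ * x := rfl

/-- `a ↦ σ_a` is continuous into `C(G, G)` (compact-open topology). -/
theorem continuous_σ : Continuous (σ : G → C(G, G)) :=
  ContinuousMap.continuous_of_continuous_uncurry _ (by
    change Continuous fun p : G × G => p.1⁻¹ * p.2
    fun_prop)

end Sigma

section Translation

variable {G : Type*} [CommGroup G] [TopologicalSpace G] [IsTopologicalGroup G]
  [MeasurableSpace G] [BorelSpace G] (μ : Measure G) [μ.IsMulLeftInvariant]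

/-- The (left) translation `σ_a : x ↦ a⁻¹ * x` preserves a left-invariant measure. -/
theorem measurePreserving_invMul (a : G) : MeasurePreserving (fun x : G => a⁻¹ * x) μ μ :=
  measurePreserving_mul_left μ a⁻¹

/-- The regular representation on `L²(μ)`: `τ_a v = v ∘ (a⁻¹ * ·)`, a linear isometry. -/
def τ (a : G) : Lp ℂ 2 μ →L[ℂ] Lp ℂ 2 μ :=
  (Lp.compMeasurePreservingₗᵢ ℂ (fun x : G => a⁻¹ * x) (measurePreserving_invMul μ a)).toContinuousLinearMap

/-- (Ported verbatim from the HodgeCMPerL package; no docstring in the source.) -/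
theorem τ_apply (a : G) (v : Lp ℂ 2 μ) :
    τ μ a v = Lp.compMeasurePreserving (fun x : G => a⁻¹ * x) (measurePreserving_invMul μ a) v := rfl

/-- (Ported verbatim from the HodgeCMPerL package; no docstring in the source.) -/
theorem coeFn_τ (a : G) (v : Lp ℂ 2 μ) : (τ μ a v : G → ℂ) =ᵐ[μ] fun x => v (a⁻¹ * x) :=
  Lp.coeFn_compMeasurePreserving v (measurePreserving_invMul μ a)

/-- (Ported verbatim from the HodgeCMPerL package; no docstring in the source.) -/
@[simp] theorem norm_τ (a : G) (v : Lp ℂ 2 μ) : ‖τ μ a v‖ = ‖v‖ :=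
  Lp.norm_compMeasurePreserving v (measurePreserving_invMul μ a)

/-- (Ported verbatim from the HodgeCMPerL package; no docstring in the source.) -/
theorem τ_mul (a b : G) (v : Lp ℂ 2 μ) : τ μ (a * b) v = τ μ a (τ μ b v) := by
  rw [Lp.ext_iff]
  have h1 := coeFn_τ μ (a * b) v
  have h2 := coeFn_τ μ a (τ μ b v)
  have h3 : (fun x => (τ μ b v : G → ℂ) (a⁻¹ * x)) =ᵐ[μ] fun x => v (b⁻¹ * (a⁻¹ * x)) :=
    (measurePreserving_invMul μ a).quasiMeasurePreserving.ae_eq_comp (coeFn_τ μ b v)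
  filter_upwards [h1, h2, h3] with x hx1 hx2 hx3
  rw [hx1, hx2, hx3, mul_inv_rev, mul_assoc]

/-- (Ported verbatim from the HodgeCMPerL package; no docstring in the source.) -/
theorem τ_one (v : Lp ℂ 2 μ) : τ μ 1 v = v := by
  rw [Lp.ext_iff]
  filter_upwards [coeFn_τ μ 1 v] with x hx
  rw [hx, inv_one, one_mul]

/-- (Ported verbatim from the HodgeCMPerL package; no docstring in the source.) -/
theorem τ_inv_τ (a : G) (v : Lp ℂ 2 μ) : τ μ a⁻¹ (τ μ a v) = v := by
  rw [← τ_mul, inv_mul_cancel, τ_one]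

/-- (Ported verbatim from the HodgeCMPerL package; no docstring in the source.) -/
theorem τ_τ_inv (a : G) (v : Lp ℂ 2 μ) : τ μ a (τ μ a⁻¹ v) = v := by
  rw [← τ_mul, mul_inv_cancel, τ_one]

/-- (Ported verbatim from the HodgeCMPerL package; no docstring in the source.) -/
theorem τ_comm (a b : G) (v : Lp ℂ 2 μ) : τ μ a (τ μ b v) = τ μ b (τ μ a v) := by
  rw [← τ_mul, ← τ_mul, mul_comm]

/-- (Ported verbatim from the HodgeCMPerL package; no docstring in the source.) -/
theorem inner_τ_τ (a : G) (v w : Lp ℂ 2 μ) : ⟪τ μ a v, τ μ a w⟫_ℂ = ⟪v, w⟫_ℂ :=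
  (Lp.compMeasurePreservingₗᵢ ℂ (fun x : G => a⁻¹ * x) (measurePreserving_invMul μ a)).inner_map_map v w

/-- `τ_a* = τ_{a⁻¹}` (unitarity), in the form used below. -/
theorem inner_τ_left (a : G) (v w : Lp ℂ 2 μ) : ⟪τ μ a v, w⟫_ℂ = ⟪v, τ μ a⁻¹ w⟫_ℂ := by
  conv_lhs => rw [← τ_τ_inv μ a w]
  exact inner_τ_τ μ a v _

/-- An operator commuting with all translations has an adjoint commuting with all translations
(because `τ_b* = τ_{b⁻¹}`). -/
theorem adjoint_τ_comm (A : Lp ℂ 2 μ →L[ℂ] Lp ℂ 2 μ)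
    (hA : ∀ (b : G) (v : Lp ℂ 2 μ), A (τ μ b v) = τ μ b (A v)) (b : G) (v : Lp ℂ 2 μ) :
    ContinuousLinearMap.adjoint A (τ μ b v) = τ μ b (ContinuousLinearMap.adjoint A v) := by
  refine ext_inner_right ℂ fun w => ?_
  rw [ContinuousLinearMap.adjoint_inner_left, inner_τ_left, ← hA,
    ← ContinuousLinearMap.adjoint_inner_left, inner_τ_left]

/-- The fixed space `W_a = {v ∈ L² : τ_a v = v}` of one translation. -/
def W (a : G) : Submodule ℂ (Lp ℂ 2 μ) :=
  LinearMap.ker ((τ μ a).toLinearMap - LinearMap.id)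

/-- (Ported verbatim from the HodgeCMPerL package; no docstring in the source.) -/
theorem mem_W {a : G} {v : Lp ℂ 2 μ} : v ∈ W μ a ↔ τ μ a v = v := by
  simp [W, sub_eq_zero]

/-- (Ported verbatim from the HodgeCMPerL package; no docstring in the source.) -/
theorem isClosed_W (a : G) : IsClosed (W μ a : Set (Lp ℂ 2 μ)) := by
  have : (W μ a : Set (Lp ℂ 2 μ)) = {v | τ μ a v = v} := by
    ext v
    exact mem_W μ
  rw [this]
  exact isClosed_eq (τ μ a).continuous continuous_id

variable [CompactSpace G] [IsFiniteMeasure μ]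

/-- On continuous functions `τ_a` is honest composition. -/
theorem τ_toLp (a : G) (f : C(G, ℂ)) :
    τ μ a (ContinuousMap.toLp (E := ℂ) 2 μ ℂ f) = ContinuousMap.toLp (E := ℂ) 2 μ ℂ (f.comp (σ a)) := by
  rw [Lp.ext_iff]
  have h1 := coeFn_τ μ a (ContinuousMap.toLp (E := ℂ) 2 μ ℂ f)
  have h2 : (fun x => (ContinuousMap.toLp (E := ℂ) 2 μ ℂ f : G → ℂ) (a⁻¹ * x)) =ᵐ[μ] fun x => f (a⁻¹ * x) :=
    (measurePreserving_invMul μ a).quasiMeasurePreserving.ae_eq_comp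
      (ContinuousMap.coeFn_toLp (E := ℂ) (p := 2) (𝕜 := ℂ) μ f)
  filter_upwards [h1, h2, ContinuousMap.coeFn_toLp (E := ℂ) (p := 2) (𝕜 := ℂ) μ (f.comp (σ a))]
    with x hx1 hx2 hx3
  rw [hx1, hx2, hx3]
  rfl

variable [T2Space G] [μ.Regular]

omit [IsFiniteMeasure μ] in
/-- Strong continuity of the regular representation: `a ↦ τ_a v` is continuous for every `v ∈ L²`. -/
theorem continuous_τ_apply (v : Lp ℂ 2 μ) : Continuous fun a : G => τ μ a v :=
  Continuous.compMeasurePreservingLp (μ := μ) (ν := μ) (E := ℂ) (p := 2) continuous_const continuous_σ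
    (fun a => measurePreserving_invMul μ a) ENNReal.ofNat_ne_top

end Translation

/-! ## 3. Convolution-type kernel operators `T_k v (x) = ∫ k(x⁻¹ y) v(y) dμ(y)` -/

section Conv

variable {G : Type*} [CommGroup G] [TopologicalSpace G] [IsTopologicalGroup G] [CompactSpace G]
  [MeasurableSpace G] [BorelSpace G] (μ : Measure G) [μ.IsMulLeftInvariant] [IsFiniteMeasure μ]

/-- The two-variable kernel `K_k (x, y) = k (x⁻¹ * y)` of a one-variable continuous `k`. -/
def K (k : C(G, ℂ)) : C(G × G, ℂ) := ⟨fun p => k (p.1⁻¹ * p.2), by fun_prop⟩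

omit [CompactSpace G] [MeasurableSpace G] [BorelSpace G] in
/-- (Ported verbatim from the HodgeCMPerL package; no docstring in the source.) -/
@[simp] theorem K_apply (k : C(G, ℂ)) (x y : G) : K k (x, y) = k (x⁻¹ * y) := rfl

/-- `T_k := 𝒯_{K_k}`, a bounded operator on `L²(μ)` (pv05 `KernelOperator.opT`). -/
def T (k : C(G, ℂ)) : Lp ℂ 2 μ →L[ℂ] Lp ℂ 2 μ := KernelOperator.opT (K k) μ μ

omit [μ.IsMulLeftInvariant] in
/-- (Ported verbatim from the HodgeCMPerL package; no docstring in the source.) -/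
theorem isCompactOperator_T (k : C(G, ℂ)) : IsCompactOperator (T μ k) := isCompactOperator_opT (K k) μ μ

/-- `T_k` commutes with translations. -/
theorem τ_T (a : G) (k : C(G, ℂ)) (v : Lp ℂ 2 μ) : τ μ a (T μ k v) = T μ k (τ μ a v) := by
  -- the auxiliary kernel `K₁ (x, y) = k (x⁻¹ * (a * y))`, with `K_k (x, y) = K₁ (x, a⁻¹ y)`
  let K₁ : C(G × G, ℂ) := ⟨fun p => k (p.1⁻¹ * (a * p.2)), by fun_prop⟩
  have hK : ∀ x y, K k (x, y) = K₁ (x, a⁻¹ * y) := by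
    intro x y
    change k (x⁻¹ * y) = k (x⁻¹ * (a * (a⁻¹ * y)))
    rw [mul_inv_cancel_left]
  have hright : T μ k (τ μ a v) = KernelOperator.opT K₁ μ μ v := by
    rw [T, τ_apply]
    exact KernelOperator.opT_comp_eq μ (measurePreserving_invMul μ a)
      (Homeomorph.mulLeft a⁻¹).measurableEmbedding K₁ (K k) hK v
  rw [hright, T, KernelOperator.opT_eq_toLp, KernelOperator.opT_eq_toLp, τ_toLp]
  congr 1
  ext x
  change KernelOperator.evalT (K k) μ v (a⁻¹ * x) = KernelOperator.evalT K₁ μ v x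
  rw [KernelOperator.evalT_eq_integral, KernelOperator.evalT_eq_integral]
  refine integral_congr_ae (Filter.Eventually.of_forall fun y => ?_)
  change k ((a⁻¹ * x)⁻¹ * y) * v y = k (x⁻¹ * (a * y)) * v y
  rw [mul_inv_rev, inv_inv, mul_assoc]

variable [T2Space G] [μ.IsOpenPosMeasure] [μ.Regular]

omit [μ.IsMulLeftInvariant] in
/-- Approximate identity, in the weak form needed: a vector killed by every `T_k` is zero
(evaluate the continuous function `T_k v` at `1`: `⟪k̄, v⟫ = 0` for all continuous `k`, and `C(G) ⊂ L²` is dense). -/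
theorem eq_zero_of_forall_T_eq_zero (v : Lp ℂ 2 μ) (hv : ∀ k : C(G, ℂ), T μ k v = 0) : v = 0 := by
  have horth : ∀ φ : C(G, ℂ), ⟪ContinuousMap.toLp (E := ℂ) 2 μ ℂ φ, v⟫_ℂ = 0 := by
    intro φ
    let k : C(G, ℂ) := ⟨fun y => conj (φ y), by fun_prop⟩
    have h1 : KernelOperator.evalTC (K k) μ v = 0 := by
      apply ContinuousMap.toLp_injective (E := ℂ) (p := 2) (𝕜 := ℂ) μ
      rw [map_zero, ← KernelOperator.opT_eq_toLp]
      exact hv k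
    have h2 : KernelOperator.evalT (K k) μ v 1 = 0 := by
      have := congrArg (fun f : C(G, ℂ) => f 1) h1
      simpa using this
    have h3 : KernelOperator.kx (K k) μ 1 = ContinuousMap.toLp (E := ℂ) 2 μ ℂ φ := by
      unfold KernelOperator.kx
      congr 1
      ext y
      simp [k]
    unfold KernelOperator.evalT at h2
    rwa [h3] at h2
  have hdense := ContinuousMap.toLp_denseRange (E := ℂ) (α := G) μ ℂ (p := 2) ENNReal.ofNat_ne_top
  have hzero : (fun w : Lp ℂ 2 μ => ⟪w, v⟫_ℂ) = fun _ => 0 := by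
    refine Continuous.ext_on hdense (continuous_id.inner continuous_const) continuous_const ?_
    rintro _ ⟨φ, rfl⟩
    exact horth φ
  have := congrFun hzero v
  simpa using this

end Conv

/-! ## 4. A Schur-type lemma: a commuting family has a common eigenline in any invariant
finite-dimensional subspace -/

section Schur

variable {V : Type*} [AddCommGroup V] [Module ℂ V] {ι : Type*}

/-- (Ported verbatim from the HodgeCMPerL package; no docstring in the source.) -/
theorem exists_common_eigenspace (f : ι → V →ₗ[ℂ] V) (hcomm : ∀ i j (x : V), f i (f j x) = f j (f i x))
    (E : Submodule ℂ V) [FiniteDimensional ℂ E] (hE : E ≠ ⊥) (hinv : ∀ i, ∀ x ∈ E, f i x ∈ E) :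
    ∃ F : Submodule ℂ V, F ≤ E ∧ F ≠ ⊥ ∧ (∀ i, ∀ x ∈ F, f i x ∈ F) ∧
      ∀ i, ∃ c : ℂ, ∀ x ∈ F, f i x = c • x := by
  classical
  have hex : ∃ n, ∃ F : Submodule ℂ V, F ≤ E ∧ F ≠ ⊥ ∧ (∀ i, ∀ x ∈ F, f i x ∈ F) ∧
      Module.finrank ℂ F = n := ⟨_, E, le_rfl, hE, hinv, rfl⟩
  obtain ⟨F, hFE, hF0, hFinv, hFn⟩ := Nat.find_spec hex
  have hmin : ∀ F' : Submodule ℂ V, F' ≤ E → F' ≠ ⊥ → (∀ i, ∀ x ∈ F', f i x ∈ F') →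
      Module.finrank ℂ F ≤ Module.finrank ℂ F' := fun F' h1 h2 h3 =>
    hFn ▸ Nat.find_min' hex ⟨F', h1, h2, h3, rfl⟩
  refine ⟨F, hFE, hF0, hFinv, fun i => ?_⟩
  haveI : FiniteDimensional ℂ F := Submodule.finiteDimensional_of_le hFE
  haveI : Nontrivial F := Submodule.nontrivial_iff_ne_bot.mpr hF0
  let g : Module.End ℂ F := (f i).restrict (hFinv i)
  obtain ⟨c, hc⟩ := Module.End.exists_eigenvalue g
  obtain ⟨y, hy, hy0⟩ := hc.exists_hasEigenvector
  have hyc : f i (y : V) = c • (y : V) := by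
    have := Module.End.mem_eigenspace_iff.mp hy
    have := congrArg Subtype.val this
    simpa [g, LinearMap.restrict_apply] using this
  let F' : Submodule ℂ V := F ⊓ LinearMap.ker (f i - c • LinearMap.id)
  have hmemF' : ∀ x : V, x ∈ F' ↔ x ∈ F ∧ f i x = c • x := by
    intro x
    simp only [F', Submodule.mem_inf, LinearMap.mem_ker, LinearMap.sub_apply, LinearMap.smul_apply,
      LinearMap.id_coe, id_eq, sub_eq_zero]
  have hF'F : F' ≤ F := inf_le_left
  have hF'0 : F' ≠ ⊥ := by
    rw [Submodule.ne_bot_iff]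
    exact ⟨y, (hmemF' y).mpr ⟨y.2, hyc⟩, fun h => hy0 (Subtype.ext h)⟩
  have hF'inv : ∀ j, ∀ x ∈ F', f j x ∈ F' := by
    intro j x hx
    rw [hmemF'] at hx ⊢
    refine ⟨hFinv j x hx.1, ?_⟩
    rw [hcomm, hx.2, map_smul]
  have hle := hmin F' (hF'F.trans hFE) hF'0 hF'inv
  have hEq : F' = F := Submodule.eq_of_le_of_finrank_le hF'F hle
  refine ⟨c, fun x hx => ?_⟩
  rw [← hEq, hmemF'] at hx
  exact hx.2

end Schur


-- port_pkg: scope closed for this part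
end CharSeparation
end PerL34
end HodgeCM
end
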